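import Summits.NavierStokesRegularity.NavierStokesRegularity.Theorems.ExtremiserTransienceTwoThirdsCellConstants
import HarnessLib

/-!
# Route `ExtremiserTransience`, crux `NearExtremalTransiencePerFlow` (stmt-NavierStokesRegularity-26567),
# LINE g10-1 «two_thirds» (ns-idea-10), stub S1a′ — BRICK 2, lemma P3f′: `L²` SIZE OF THE (OPERATOR-VALUED) PALINSTROPHY OFFSET

`--supports stmt-NavierStokesRegularity-26567` (helper; prover seat ns-net-p2 g13).  The palinstrophy offset `D(curl φ) − χ•Dω` of a piece takes values
in `ℝ³ →L ℝ³`, so the six-term lemma of `…TwoThirdsPieceL2` (p732466, stated for `ℝ³`-valued fields) is repeated here for an arbitrary normed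
codomain (`integral_sq_le_of_affine_six_op`), together with the corresponding cell budget `cell_e2_L2_op` (verbatim `cell_e2_L2` of
`…TwoThirdsCellPiece`, p733375).  HONEST FRAMING: measure bookkeeping; nothing about Navier–Stokes is proved; no summit is proved by a line. [folklore]
-/

noncomputable section

open scoped Topology InnerProductSpace RealInnerProductSpace ENNReal NNReal ContDiff
open MeasureTheory Filter Set Metric
open Literature.Analysis.FluidPDE
open Summit.NavierStokesRegularity.NavierStokesRegularity.Theorems.DepletionLadder.KStar.HalfSpace
open Summit.NavierStokesRegularity.NavierStokesRegularity.Theorems.NearExtremalTransiencePerFlow.LocalMaximiser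

namespace Summit.NavierStokesRegularity.NavierStokesRegularity.Theorems.NearExtremalTransiencePerFlow.TwoThirds

-- the summit's namespace repeats the problem name by convention (D-0017)
set_option linter.dupNamespace false

section L2Op

variable {L S : Set E3}

/-- **Six-term version, operator-valued offset.**  `‖e‖ ≤ α + Σ_{k≤5} βₖ fₖ` on `L ⊆ S`, `e = 0` off `L` ⟹ `∫‖e‖² ≤ 6(α² vol S + Σ βₖ² ∫_S fₖ²)`. [folklore] -/
theorem integral_sq_le_of_affine_six_op {F : Type*} [NormedAddCommGroup F] {e : E3 → F} (hLS : L ⊆ S) (hS : MeasurableSet S) (hSvol : volume S ≠ ⊤)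
    (he0 : ∀ x, x ∉ L → e x = 0) (hie : Integrable fun x => ‖e x‖ ^ 2)
    {α b₁ b₂ b₃ b₄ b₅ : ℝ} {f₁ f₂ f₃ f₄ f₅ : E3 → ℝ}
    (hf₁ : IntegrableOn (fun x => f₁ x ^ 2) S) (hf₂ : IntegrableOn (fun x => f₂ x ^ 2) S) (hf₃ : IntegrableOn (fun x => f₃ x ^ 2) S)
    (hf₄ : IntegrableOn (fun x => f₄ x ^ 2) S) (hf₅ : IntegrableOn (fun x => f₅ x ^ 2) S)
    (hle : ∀ x ∈ L, ‖e x‖ ≤ α + b₁ * f₁ x + b₂ * f₂ x + b₃ * f₃ x + b₄ * f₄ x + b₅ * f₅ x) :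
    ∫ x, ‖e x‖ ^ 2 ≤ 6 * (α ^ 2 * (volume S).toReal + b₁ ^ 2 * (∫ x in S, f₁ x ^ 2) + b₂ ^ 2 * (∫ x in S, f₂ x ^ 2) +
      b₃ ^ 2 * (∫ x in S, f₃ x ^ 2) + b₄ ^ 2 * (∫ x in S, f₄ x ^ 2) + b₅ ^ 2 * (∫ x in S, f₅ x ^ 2)) := by
  set F : E3 → ℝ := fun y => 6 * α ^ 2 + 6 * (b₁ ^ 2 * f₁ y ^ 2) + 6 * (b₂ ^ 2 * f₂ y ^ 2) + 6 * (b₃ ^ 2 * f₃ y ^ 2) +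
    6 * (b₄ ^ 2 * f₄ y ^ 2) + 6 * (b₅ ^ 2 * f₅ y ^ 2) with hF
  have hF0 : ∀ y, 0 ≤ F y := fun y => by rw [hF]; positivity
  have hpt : ∀ x, ‖e x‖ ^ 2 ≤ S.indicator F x := by
    intro x
    by_cases hx : x ∈ L
    · have hxS : x ∈ S := hLS hx
      rw [indicator_of_mem hxS, hF]
      have h := hle x hx
      have h2 : ‖e x‖ ^ 2 ≤ (α + b₁ * f₁ x + b₂ * f₂ x + b₃ * f₃ x + b₄ * f₄ x + b₅ * f₅ x) ^ 2 :=
        pow_le_pow_left₀ (norm_nonneg _) h 2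
      nlinarith only [h2, sq_nonneg (α - b₁ * f₁ x), sq_nonneg (α - b₂ * f₂ x), sq_nonneg (α - b₃ * f₃ x), sq_nonneg (α - b₄ * f₄ x),
        sq_nonneg (α - b₅ * f₅ x), sq_nonneg (b₁ * f₁ x - b₂ * f₂ x), sq_nonneg (b₁ * f₁ x - b₃ * f₃ x),
        sq_nonneg (b₁ * f₁ x - b₄ * f₄ x), sq_nonneg (b₁ * f₁ x - b₅ * f₅ x), sq_nonneg (b₂ * f₂ x - b₃ * f₃ x),
        sq_nonneg (b₂ * f₂ x - b₄ * f₄ x), sq_nonneg (b₂ * f₂ x - b₅ * f₅ x), sq_nonneg (b₃ * f₃ x - b₄ * f₄ x),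
        sq_nonneg (b₃ * f₃ x - b₅ * f₅ x), sq_nonneg (b₄ * f₄ x - b₅ * f₅ x)]
    · rw [he0 x hx, norm_zero, zero_pow two_ne_zero]
      exact indicator_nonneg (fun y _ => hF0 y) x
  haveI : IsFiniteMeasure (volume.restrict S) := ⟨by rw [Measure.restrict_apply_univ]; exact hSvol.lt_top⟩
  have hFi : IntegrableOn F S := by
    rw [hF]
    exact (((((integrable_const _).add ((hf₁.const_mul _).const_mul _)).add ((hf₂.const_mul _).const_mul _)).add
      ((hf₃.const_mul _).const_mul _)).add ((hf₄.const_mul _).const_mul _)).add ((hf₅.const_mul _).const_mul _)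
  have hi : Integrable (S.indicator F) := (integrable_indicator_iff hS).2 hFi
  have hmono := integral_mono hie hi hpt
  rw [integral_indicator hS] at hmono
  have hval : ∫ x in S, F x = 6 * α ^ 2 * (volume S).toReal + 6 * (b₁ ^ 2 * (∫ x in S, f₁ x ^ 2)) + 6 * (b₂ ^ 2 * (∫ x in S, f₂ x ^ 2)) +
      6 * (b₃ ^ 2 * (∫ x in S, f₃ x ^ 2)) + 6 * (b₄ ^ 2 * (∫ x in S, f₄ x ^ 2)) + 6 * (b₅ ^ 2 * (∫ x in S, f₅ x ^ 2)) := by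
    have i0 : Integrable (fun _ : E3 => 6 * α ^ 2) (volume.restrict S) := integrable_const _
    have i1 : Integrable (fun y => 6 * (b₁ ^ 2 * f₁ y ^ 2)) (volume.restrict S) := (hf₁.const_mul _).const_mul _
    have i2 : Integrable (fun y => 6 * (b₂ ^ 2 * f₂ y ^ 2)) (volume.restrict S) := (hf₂.const_mul _).const_mul _
    have i3 : Integrable (fun y => 6 * (b₃ ^ 2 * f₃ y ^ 2)) (volume.restrict S) := (hf₃.const_mul _).const_mul _
    have i4 : Integrable (fun y => 6 * (b₄ ^ 2 * f₄ y ^ 2)) (volume.restrict S) := (hf₄.const_mul _).const_mul _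
    have i5 : Integrable (fun y => 6 * (b₅ ^ 2 * f₅ y ^ 2)) (volume.restrict S) := (hf₅.const_mul _).const_mul _
    have s1 : Integrable (fun y => 6 * α ^ 2 + 6 * (b₁ ^ 2 * f₁ y ^ 2)) (volume.restrict S) := i0.add i1
    have s2 : Integrable (fun y => 6 * α ^ 2 + 6 * (b₁ ^ 2 * f₁ y ^ 2) + 6 * (b₂ ^ 2 * f₂ y ^ 2)) (volume.restrict S) := s1.add i2
    have s3 : Integrable (fun y => 6 * α ^ 2 + 6 * (b₁ ^ 2 * f₁ y ^ 2) + 6 * (b₂ ^ 2 * f₂ y ^ 2) + 6 * (b₃ ^ 2 * f₃ y ^ 2))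
      (volume.restrict S) := s2.add i3
    have s4 : Integrable (fun y => 6 * α ^ 2 + 6 * (b₁ ^ 2 * f₁ y ^ 2) + 6 * (b₂ ^ 2 * f₂ y ^ 2) + 6 * (b₃ ^ 2 * f₃ y ^ 2) +
      6 * (b₄ ^ 2 * f₄ y ^ 2)) (volume.restrict S) := s3.add i4
    have e5 : ∫ x in S, F x = (∫ x in S, (6 * α ^ 2 + 6 * (b₁ ^ 2 * f₁ x ^ 2) + 6 * (b₂ ^ 2 * f₂ x ^ 2) + 6 * (b₃ ^ 2 * f₃ x ^ 2) +
        6 * (b₄ ^ 2 * f₄ x ^ 2))) + ∫ x in S, 6 * (b₅ ^ 2 * f₅ x ^ 2) := by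
      rw [hF]; exact integral_add s4 i5
    have e4 : ∫ x in S, (6 * α ^ 2 + 6 * (b₁ ^ 2 * f₁ x ^ 2) + 6 * (b₂ ^ 2 * f₂ x ^ 2) + 6 * (b₃ ^ 2 * f₃ x ^ 2) + 6 * (b₄ ^ 2 * f₄ x ^ 2)) =
        (∫ x in S, (6 * α ^ 2 + 6 * (b₁ ^ 2 * f₁ x ^ 2) + 6 * (b₂ ^ 2 * f₂ x ^ 2) + 6 * (b₃ ^ 2 * f₃ x ^ 2))) +
          ∫ x in S, 6 * (b₄ ^ 2 * f₄ x ^ 2) := integral_add s3 i4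
    have e3 : ∫ x in S, (6 * α ^ 2 + 6 * (b₁ ^ 2 * f₁ x ^ 2) + 6 * (b₂ ^ 2 * f₂ x ^ 2) + 6 * (b₃ ^ 2 * f₃ x ^ 2)) =
        (∫ x in S, (6 * α ^ 2 + 6 * (b₁ ^ 2 * f₁ x ^ 2) + 6 * (b₂ ^ 2 * f₂ x ^ 2))) + ∫ x in S, 6 * (b₃ ^ 2 * f₃ x ^ 2) :=
      integral_add s2 i3
    have e2 : ∫ x in S, (6 * α ^ 2 + 6 * (b₁ ^ 2 * f₁ x ^ 2) + 6 * (b₂ ^ 2 * f₂ x ^ 2)) =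
        (∫ x in S, (6 * α ^ 2 + 6 * (b₁ ^ 2 * f₁ x ^ 2))) + ∫ x in S, 6 * (b₂ ^ 2 * f₂ x ^ 2) := integral_add s1 i2
    have e1 : ∫ x in S, (6 * α ^ 2 + 6 * (b₁ ^ 2 * f₁ x ^ 2)) = (∫ x in S, (6 * α ^ 2 : ℝ)) + ∫ x in S, 6 * (b₁ ^ 2 * f₁ x ^ 2) :=
      integral_add i0 i1
    have c0 : ∫ x in S, (6 * α ^ 2 : ℝ) = 6 * α ^ 2 * (volume S).toReal := by
      rw [setIntegral_const, smul_eq_mul, Measure.real, mul_comm]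
    have c1 : ∫ x in S, 6 * (b₁ ^ 2 * f₁ x ^ 2) = 6 * (b₁ ^ 2 * (∫ x in S, f₁ x ^ 2)) := by rw [integral_const_mul, integral_const_mul]
    have c2 : ∫ x in S, 6 * (b₂ ^ 2 * f₂ x ^ 2) = 6 * (b₂ ^ 2 * (∫ x in S, f₂ x ^ 2)) := by rw [integral_const_mul, integral_const_mul]
    have c3 : ∫ x in S, 6 * (b₃ ^ 2 * f₃ x ^ 2) = 6 * (b₃ ^ 2 * (∫ x in S, f₃ x ^ 2)) := by rw [integral_const_mul, integral_const_mul]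
    have c4 : ∫ x in S, 6 * (b₄ ^ 2 * f₄ x ^ 2) = 6 * (b₄ ^ 2 * (∫ x in S, f₄ x ^ 2)) := by rw [integral_const_mul, integral_const_mul]
    have c5 : ∫ x in S, 6 * (b₅ ^ 2 * f₅ x ^ 2) = 6 * (b₅ ^ 2 * (∫ x in S, f₅ x ^ 2)) := by rw [integral_const_mul, integral_const_mul]
    linarith only [e5, e4, e3, e2, e1, c0, c1, c2, c3, c4, c5]
  linarith only [hmono, hval]


end L2Op

section CellOp

variable {w ψ : E3 → E3} {c : E3} {ρ a K₁ K₂ A_E C : ℝ}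

set_option maxHeartbeats 400000 in
/-- **`L²` budget of the palinstrophy offset of a cell piece** (shape of `norm_fderiv_curl_piece_sub_le_of_sizes`; the offset is OPERATOR valued). [folklore] -/
theorem cell_e2_L2_op {e : E3 → (E3 →L[ℝ] E3)} {K₃ : ℝ} (hρ : 2 ≤ ρ) (ha : 0 ≤ a) (hK₁ : 0 ≤ K₁) (hK₂ : 0 ≤ K₂) (hK₃ : 0 ≤ K₃) (hAE : 0 ≤ A_E)
    (hC : 0 ≤ C) (hw : ContDiff ℝ (⊤ : ℕ∞) w)
    (hgr : ∫ x in ball c (2 * ρ ^ 8), ‖w x‖ ^ 2 ≤ A_E * (2 * ρ ^ 8))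
    (iDψ : Integrable fun x => ‖fderiv ℝ ψ x‖ ^ 2) (hDψ : ∫ x, ‖fderiv ℝ ψ x‖ ^ 2 ≤ C * A_E * ρ ^ 8)
    (iD2ψ : Integrable fun x => ‖iteratedFDeriv ℝ 2 ψ x‖ ^ 2)
    (hD2ψ : ∫ x, ‖iteratedFDeriv ℝ 2 ψ x‖ ^ 2 ≤ C * (Zb w c (4 * ρ ^ 8) + A_E / ρ ^ 8))
    (he0 : ∀ x, x ∉ ball c (ρ ^ 8 + ρ ^ 7) \ ball c (ρ ^ 8) → e x = 0) (hie : Integrable fun x => ‖e x‖ ^ 2)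
    (hle : ∀ x ∈ ball c (ρ ^ 8 + ρ ^ 7) \ ball c (ρ ^ 8), ‖e x‖ ≤
      ‖curlCLM‖ * (2 * K₂ / (ρ ^ 7) ^ 2 * (a / ρ ^ 8) + K₁ / ρ ^ 7 * (a / ρ ^ 16)) + ‖curlCLM‖ * ‖curlCLM‖ * (6 * K₃ / (ρ ^ 7) ^ 3) * (a * ρ) +
        K₁ / ρ ^ 7 * ‖curl w x‖ + ‖curlCLM‖ * (2 * K₂ / (ρ ^ 7) ^ 2) * ‖w x‖ + ‖curlCLM‖ * (K₁ / ρ ^ 7) * ‖fderiv ℝ w x‖ +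
        2 * ‖curlCLM‖ * ‖curlCLM‖ * (2 * K₂ / (ρ ^ 7) ^ 2) * ‖fderiv ℝ ψ x‖ + ‖curlCLM‖ * ‖curlCLM‖ * (K₁ / ρ ^ 7) * ‖iteratedFDeriv ℝ 2 ψ x‖) :
    ∫ x, ‖e x‖ ^ 2 ≤ 6 * (34 * (2 * ‖curlCLM‖ * K₂ * a + ‖curlCLM‖ * K₁ * a + 6 * ‖curlCLM‖ * ‖curlCLM‖ * K₃ * a) ^ 2 +
      K₁ ^ 2 + 8 * ‖curlCLM‖ ^ 2 * K₂ ^ 2 * A_E + ‖curlCLM‖ ^ 2 * K₁ ^ 2 + 16 * ‖curlCLM‖ ^ 4 * K₂ ^ 2 * C * A_E +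
      ‖curlCLM‖ ^ 4 * K₁ ^ 2 * C * (1 + A_E)) *
      (Zb w c (2 * ρ ^ 8) + Zb w c (4 * ρ ^ 8) + (∫ x in ball c (2 * ρ ^ 8), ‖fderiv ℝ w x‖ ^ 2) + 1) / ρ ^ 2 := by
  have hρ0 : 0 < ρ := by linarith
  have hρ78 : ρ ^ 8 + ρ ^ 7 ≤ 2 * ρ ^ 8 := by
    have : ρ ^ 7 ≤ ρ ^ 8 := by rw [show ρ ^ 8 = ρ * ρ ^ 7 by ring]; exact le_mul_of_one_le_left (by positivity) (by linarith)
    linarith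
  have hLS : ball c (ρ ^ 8 + ρ ^ 7) \ ball c (ρ ^ 8) ⊆ ball c (2 * ρ ^ 8) := fun x hx => ball_subset_ball hρ78 hx.1
  obtain ⟨hSvol, hvol⟩ := volume_ball_two_rho_le c hρ0
  have hwc : Continuous w := hw.continuous
  have hw1c : ContDiff ℝ 1 w := hw.of_le (by norm_cast)
  have hf₁ : IntegrableOn (fun x => ‖curl w x‖ ^ 2) (ball c (2 * ρ ^ 8)) :=
    (((continuous_curl hw1c).norm.pow 2).continuousOn.integrableOn_compact (isCompact_closedBall c (2 * ρ ^ 8))).mono_set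
      ball_subset_closedBall
  have hf₂ : IntegrableOn (fun x => ‖w x‖ ^ 2) (ball c (2 * ρ ^ 8)) :=
    ((hwc.norm.pow 2).continuousOn.integrableOn_compact (isCompact_closedBall c (2 * ρ ^ 8))).mono_set ball_subset_closedBall
  have hf₃ : IntegrableOn (fun x => ‖fderiv ℝ w x‖ ^ 2) (ball c (2 * ρ ^ 8)) :=
    (((hw.continuous_fderiv (by simp)).norm.pow 2).continuousOn.integrableOn_compact (isCompact_closedBall c (2 * ρ ^ 8))).mono_set
      ball_subset_closedBall
  have hf₄ : IntegrableOn (fun x => ‖fderiv ℝ ψ x‖ ^ 2) (ball c (2 * ρ ^ 8)) := iDψ.integrableOn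
  have hf₅ : IntegrableOn (fun x => ‖iteratedFDeriv ℝ 2 ψ x‖ ^ 2) (ball c (2 * ρ ^ 8)) := iD2ψ.integrableOn
  have hmain := integral_sq_le_of_affine_six_op (e := e) hLS measurableSet_ball hSvol he0 hie
    (α := ‖curlCLM‖ * (2 * K₂ / (ρ ^ 7) ^ 2 * (a / ρ ^ 8) + K₁ / ρ ^ 7 * (a / ρ ^ 16)) + ‖curlCLM‖ * ‖curlCLM‖ * (6 * K₃ / (ρ ^ 7) ^ 3) * (a * ρ))
    (b₁ := K₁ / ρ ^ 7) (b₂ := ‖curlCLM‖ * (2 * K₂ / (ρ ^ 7) ^ 2)) (b₃ := ‖curlCLM‖ * (K₁ / ρ ^ 7))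
    (b₄ := 2 * ‖curlCLM‖ * ‖curlCLM‖ * (2 * K₂ / (ρ ^ 7) ^ 2)) (b₅ := ‖curlCLM‖ * ‖curlCLM‖ * (K₁ / ρ ^ 7))
    (f₁ := fun x => ‖curl w x‖) (f₂ := fun x => ‖w x‖) (f₃ := fun x => ‖fderiv ℝ w x‖) (f₄ := fun x => ‖fderiv ℝ ψ x‖)
    (f₅ := fun x => ‖iteratedFDeriv ℝ 2 ψ x‖) hf₁ hf₂ hf₃ hf₄ hf₅ (fun x hx => by
      have := hle x hx; linarith only [this])
  have hZ₂ : ∫ x in ball c (2 * ρ ^ 8), ‖curl w x‖ ^ 2 = Zb w c (2 * ρ ^ 8) := rfl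
  have hgS : ∫ x in ball c (2 * ρ ^ 8), ‖fderiv ℝ ψ x‖ ^ 2 ≤ C * A_E * ρ ^ 8 :=
    (setIntegral_le_integral iDψ (ae_of_all _ fun x => sq_nonneg _)).trans hDψ
  have hgS2 : ∫ x in ball c (2 * ρ ^ 8), ‖iteratedFDeriv ℝ 2 ψ x‖ ^ 2 ≤ C * (Zb w c (4 * ρ ^ 8) + A_E / ρ ^ 8) :=
    (setIntegral_le_integral iD2ψ (ae_of_all _ fun x => sq_nonneg _)).trans hD2ψ
  have hZ20 : 0 ≤ Zb w c (2 * ρ ^ 8) := Zb_nonneg w c _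
  have hZ40 : 0 ≤ Zb w c (4 * ρ ^ 8) := Zb_nonneg w c _
  have hD20 : 0 ≤ ∫ x in ball c (2 * ρ ^ 8), ‖fderiv ℝ w x‖ ^ 2 := setIntegral_nonneg measurableSet_ball fun x _ => sq_nonneg _
  obtain ⟨c1, c2, c3, c4, c5, c6⟩ := cell_e2_consts (a := a) (cc := ‖curlCLM‖) (K₁ := K₁) (K₂ := K₂) (K₃ := K₃) (A_E := A_E) (C := C)
    hρ ha (norm_nonneg curlCLM) hK₁ hK₂ hK₃ hAE hC hZ20 hD20 hZ40
  have u1 := mul_le_mul_of_nonneg_left hvol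
    (sq_nonneg (‖curlCLM‖ * (2 * K₂ / (ρ ^ 7) ^ 2 * (a / ρ ^ 8) + K₁ / ρ ^ 7 * (a / ρ ^ 16)) +
      ‖curlCLM‖ * ‖curlCLM‖ * (6 * K₃ / (ρ ^ 7) ^ 3) * (a * ρ)))
  have u3 := mul_le_mul_of_nonneg_left hgr (sq_nonneg (‖curlCLM‖ * (2 * K₂ / (ρ ^ 7) ^ 2)))
  have u4 := mul_le_mul_of_nonneg_left hgS (sq_nonneg (2 * ‖curlCLM‖ * ‖curlCLM‖ * (2 * K₂ / (ρ ^ 7) ^ 2)))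
  have u5 := mul_le_mul_of_nonneg_left hgS2 (sq_nonneg (‖curlCLM‖ * ‖curlCLM‖ * (K₁ / ρ ^ 7)))
  rw [hZ₂] at hmain
  -- collect: each of the six terms is `≤ (its constant)·(budget)/ρ²`
  have hρ2 : 0 < ρ ^ 2 := by positivity
  set S : ℝ := Zb w c (2 * ρ ^ 8) + Zb w c (4 * ρ ^ 8) + (∫ x in ball c (2 * ρ ^ 8), ‖fderiv ℝ w x‖ ^ 2) + 1 with hS
  have hS1 : 1 ≤ S := by rw [hS]; linarith
  have hS0 : 0 ≤ S := by linarith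
  have v1 : 34 * (2 * ‖curlCLM‖ * K₂ * a + ‖curlCLM‖ * K₁ * a + 6 * ‖curlCLM‖ * ‖curlCLM‖ * K₃ * a) ^ 2 / ρ ^ 2 ≤
      34 * (2 * ‖curlCLM‖ * K₂ * a + ‖curlCLM‖ * K₁ * a + 6 * ‖curlCLM‖ * ‖curlCLM‖ * K₃ * a) ^ 2 * S / ρ ^ 2 :=
    div_le_div_of_nonneg_right (le_mul_of_one_le_right (by positivity) hS1) hρ2.le
  have v2 : K₁ ^ 2 * Zb w c (2 * ρ ^ 8) / ρ ^ 2 ≤ K₁ ^ 2 * S / ρ ^ 2 :=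
    div_le_div_of_nonneg_right (mul_le_mul_of_nonneg_left (by rw [hS]; linarith) (sq_nonneg _)) hρ2.le
  have v3 : 8 * ‖curlCLM‖ ^ 2 * K₂ ^ 2 * A_E / ρ ^ 2 ≤ 8 * ‖curlCLM‖ ^ 2 * K₂ ^ 2 * A_E * S / ρ ^ 2 :=
    div_le_div_of_nonneg_right (le_mul_of_one_le_right (by positivity) hS1) hρ2.le
  have v4 : ‖curlCLM‖ ^ 2 * K₁ ^ 2 * (∫ x in ball c (2 * ρ ^ 8), ‖fderiv ℝ w x‖ ^ 2) / ρ ^ 2 ≤ ‖curlCLM‖ ^ 2 * K₁ ^ 2 * S / ρ ^ 2 :=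
    div_le_div_of_nonneg_right (mul_le_mul_of_nonneg_left (by rw [hS]; linarith) (by positivity)) hρ2.le
  have v5 : 16 * ‖curlCLM‖ ^ 4 * K₂ ^ 2 * C * A_E / ρ ^ 2 ≤ 16 * ‖curlCLM‖ ^ 4 * K₂ ^ 2 * C * A_E * S / ρ ^ 2 :=
    div_le_div_of_nonneg_right (le_mul_of_one_le_right (by positivity) hS1) hρ2.le
  have v6 : ‖curlCLM‖ ^ 4 * K₁ ^ 2 * C * (Zb w c (4 * ρ ^ 8) + A_E) / ρ ^ 2 ≤ ‖curlCLM‖ ^ 4 * K₁ ^ 2 * C * (1 + A_E) * S / ρ ^ 2 := by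
    refine div_le_div_of_nonneg_right ?_ hρ2.le
    have hZ4S : Zb w c (4 * ρ ^ 8) ≤ S := by rw [hS]; linarith
    have : Zb w c (4 * ρ ^ 8) + A_E ≤ (1 + A_E) * S := by nlinarith only [hZ4S, hS1, hAE, hZ40]
    calc ‖curlCLM‖ ^ 4 * K₁ ^ 2 * C * (Zb w c (4 * ρ ^ 8) + A_E) ≤ ‖curlCLM‖ ^ 4 * K₁ ^ 2 * C * ((1 + A_E) * S) :=
          mul_le_mul_of_nonneg_left this (by positivity)
      _ = _ := by ring
  have e : 6 * (34 * (2 * ‖curlCLM‖ * K₂ * a + ‖curlCLM‖ * K₁ * a + 6 * ‖curlCLM‖ * ‖curlCLM‖ * K₃ * a) ^ 2 +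
      K₁ ^ 2 + 8 * ‖curlCLM‖ ^ 2 * K₂ ^ 2 * A_E + ‖curlCLM‖ ^ 2 * K₁ ^ 2 + 16 * ‖curlCLM‖ ^ 4 * K₂ ^ 2 * C * A_E +
      ‖curlCLM‖ ^ 4 * K₁ ^ 2 * C * (1 + A_E)) * S / ρ ^ 2 =
      6 * (34 * (2 * ‖curlCLM‖ * K₂ * a + ‖curlCLM‖ * K₁ * a + 6 * ‖curlCLM‖ * ‖curlCLM‖ * K₃ * a) ^ 2 * S / ρ ^ 2 +
        K₁ ^ 2 * S / ρ ^ 2 + 8 * ‖curlCLM‖ ^ 2 * K₂ ^ 2 * A_E * S / ρ ^ 2 + ‖curlCLM‖ ^ 2 * K₁ ^ 2 * S / ρ ^ 2 +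
        16 * ‖curlCLM‖ ^ 4 * K₂ ^ 2 * C * A_E * S / ρ ^ 2 + ‖curlCLM‖ ^ 4 * K₁ ^ 2 * C * (1 + A_E) * S / ρ ^ 2) := by
    field_simp
  rw [e]
  linarith only [hmain, u1, u3, u4, u5, c1, c2, c3, c4, c5, c6, v1, v2, v3, v4, v5, v6]


end CellOp

end Summit.NavierStokesRegularity.NavierStokesRegularity.Theorems.NearExtremalTransiencePerFlow.TwoThirds

end
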